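import Literature.AlgebraicGeometry.Resolution.TameTowerRebase
import Mathlib.GroupTheory.Sylow
import Mathlib.GroupTheory.Nilpotent
import Mathlib.FieldTheory.PurelyInseparable.Basic
import Mathlib.FieldTheory.KummerPolynomial
import Mathlib.Order.Atoms.Finite
import HarnessLib

/-!
# Towers of normal extensions of degree `p`: the `p`-group case and the purely inseparable case

Topic: `Literature/AlgebraicGeometry/Resolution` (valued function fields). PROVED field theory
behind the reduction step of F.-V. Kuhlmann, *Elimination of ramification I: The generalized
stability theorem*, Trans. AMS 362 (2010) = arXiv:1003.5678, §5, proof of (R4), p. 19: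

> It follows from the general theory of `p`-groups (cf. [H], Chapter III, §7, Satz 7.2 and the
> following remark) via Galois correspondence that the maximal separable subextension of
> `E.F^r|F^r` is a finite tower of Galois extensions of degree `p`. Consequently, `E.F^r|F^r`
> is a finite tower of normal extensions of degree `p`, either Galois or purely inseparable.

rendered for the inductive predicate `IsNormalPTower` of `HenselizedFunctionFields.lean`
(subfields of one ambient field `Ω`; rebasing bookkeeping in `TameTowerRebase.lean`):

* `index_eq_of_isCoatom` — a maximal subgroup of a finite `p`-group is normal of index `p`
  (maximal subgroups of nilpotent groups are normal,
  `Subgroup.NormalizerCondition.normal_of_coatom`; an element of order `p` of the quotient).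
* `isNormalPTower_of_isGalois_of_isPGroup` — **the `p`-group case**: if `L|M` is finite Galois
  with Galois group a `p`-group, then EVERY intermediate field of `L|M` is reached from `M` by a
  finite tower of normal (indeed Galois) extensions of degree `p`.
* `isNormalPTower_of_forall_pow_mem`, `isNormalPTower_of_isPurelyInseparable` — **the purely
  inseparable case**: in characteristic `p`, a finite extension `E|M` inside `Ω` with
  `x^{p^k} ∈ M` for all `x ∈ E` (e.g. a finite purely inseparable one) is a tower of purely
  inseparable, hence normal, extensions of degree `p`; in characteristic `0` such an extension is
  trivial (`isNormalPTower_of_isPurelyInseparable_of_charZero`).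

## Sources

* F.-V. Kuhlmann, loc. cit., §5, p. 19. The group theory ([H] = B. Huppert, *Endliche
  Gruppen I*, III §7, Satz 7.2) is Mathlib's (`IsPGroup.isNilpotent`,
  `Group.normalizerCondition_of_isNilpotent`, `exists_prime_orderOf_dvd_card'`).
-/

noncomputable section

open Module IntermediateField Polynomial

namespace Literature.AlgebraicGeometry.Resolution

universe u

variable {Ω : Type u} [Field Ω]

/-! ### Maximal subgroups of finite `p`-groups -/

/-- In a finite `p`-group, a maximal subgroup is normal of index `p`. [folklore] -/
theorem index_eq_of_isCoatom {p : ℕ} [hp : Fact p.Prime] {G : Type*} [Group G] [Finite G]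
    (hG : IsPGroup p G) {H : Subgroup G} (hH : IsCoatom H) : H.Normal ∧ H.index = p := by
  haveI : Group.IsNilpotent G := hG.isNilpotent
  have hN : H.Normal := Subgroup.NormalizerCondition.normal_of_coatom H
    Group.normalizerCondition_of_isNilpotent hH
  refine ⟨hN, ?_⟩
  haveI := hN
  haveI : H.FiniteIndex := Subgroup.finiteIndex_of_finite
  -- `G ⧸ H` is a non-trivial `p`-group; an element of order `p` generates a subgroup whose
  -- preimage lies strictly above `H`, hence is everything
  obtain ⟨k, hk⟩ := hG.index H
  have hk0 : k ≠ 0 := by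
    rintro rfl
    rw [pow_zero] at hk
    exact hH.1 (Subgroup.index_eq_one.mp hk)
  have hdvd : p ∣ Nat.card (G ⧸ H) := by
    rw [← Subgroup.index_eq_card, hk]
    exact dvd_pow_self p hk0
  obtain ⟨g, hg⟩ := exists_prime_orderOf_dvd_card' p hdvd
  let Q : Subgroup G := (Subgroup.zpowers g).comap (QuotientGroup.mk' H)
  have hHQ : H ≤ Q := by
    intro x hx
    change QuotientGroup.mk' H x ∈ Subgroup.zpowers g
    rw [QuotientGroup.mk'_apply, (QuotientGroup.eq_one_iff x).mpr hx]
    exact one_mem _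
  have hne : H ≠ Q := by
    intro hHQ'
    obtain ⟨x, rfl⟩ := QuotientGroup.mk'_surjective H g
    have hxQ : x ∈ Q := Subgroup.mem_zpowers _
    rw [← hHQ'] at hxQ
    have h1 : (QuotientGroup.mk' H x) = 1 := by
      rw [QuotientGroup.mk'_apply]
      exact (QuotientGroup.eq_one_iff x).mpr hxQ
    rw [h1, orderOf_one] at hg
    exact hp.out.one_lt.ne' hg.symm
  have hQtop : Q = ⊤ := hH.2 Q (lt_of_le_of_ne hHQ hne)
  have hztop : Subgroup.zpowers g = ⊤ := by
    have := Subgroup.comap_injective (QuotientGroup.mk'_surjective H)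
    apply this
    rw [Subgroup.comap_top]
    exact hQtop
  rw [Subgroup.index_eq_card, ← Subgroup.card_top (G := G ⧸ H), ← hztop, Nat.card_zpowers, hg]

/-! ### The `p`-group case -/

/-- **Every intermediate field of a finite Galois extension with `p`-group Galois group is
reached by a tower of normal extensions of degree `p`** (Kuhlmann 2010, p. 19: "It follows from
the general theory of `p`-groups … via Galois correspondence that [the extension] is a finite
tower of Galois extensions of degree `p`"). Inside `Ω`: `M ≤ Ω` a subfield, `L|M` finite Galois
with `Gal(L|M)` a `p`-group, `K` an intermediate field; then `IsNormalPTower p M K`. Proof by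
induction on `[L : M]`: if `K ≠ M`, the subgroup fixing `K` lies in a maximal subgroup `H'`,
normal of index `p`; its fixed field `S₁ ≤ K` is Galois of degree `p` over `M` (first step), and
`L|S₁` is again Galois with `p`-group `H'` of smaller order (induction).
[cite: Kuhlmann2010, Section 5, proof of (R4) (p. 19)] -/
theorem isNormalPTower_of_isGalois_of_isPGroup {p : ℕ} [Fact p.Prime] (n : ℕ) :
    ∀ (M : Subfield Ω) (L : IntermediateField M Ω) [FiniteDimensional M L] [IsGalois M L],
      IsPGroup p (L ≃ₐ[M] L) → finrank M L = n →
      ∀ K : IntermediateField M L, IsNormalPTower p M (lift K).toSubfield := by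
  induction n using Nat.strong_induction_on with
  | _ n ih =>
  intro M L _ _ hG hn K
  let H : Subgroup (L ≃ₐ[M] L) := K.fixingSubgroup
  by_cases hH : H = ⊤
  · -- `K = M`
    have hK : K = ⊥ := by
      rw [← IntermediateField.finrank_eq_one_iff,
        IntermediateField.finrank_eq_fixingSubgroup_index]
      change H.index = 1
      rw [hH, Subgroup.index_top]
    rw [hK, show lift (⊥ : IntermediateField M L) = ⊥ from IntermediateField.map_bot _,
      bot_toSubfield]
    exact IsNormalPTower.refl M
  · -- a maximal subgroup `H' ≥ H`, normal of index `p`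
    obtain ⟨H', hH'c, hHH'⟩ := (eq_top_or_exists_le_coatom H).resolve_left hH
    obtain ⟨hH'n, hH'i⟩ := index_eq_of_isCoatom hG hH'c
    haveI := hH'n
    let S₁ : IntermediateField M L := fixedField H'
    haveI : IsGalois M S₁ := IsGalois.of_fixedField_normal_subgroup H'
    have hS₁d : finrank M S₁ = p := by
      rw [IntermediateField.finrank_eq_fixingSubgroup_index,
        IntermediateField.fixingSubgroup_fixedField]
      exact hH'i
    have hS₁K : S₁ ≤ K := by
      intro x hx
      rw [← IsGalois.fixedField_fixingSubgroup K]
      intro σ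
      exact hx ⟨σ, hHH' σ.2⟩
    -- first step
    have hstep : IsNormalStep p M (lift S₁).toSubfield := isNormalStep_lift S₁ hS₁d
    -- rebase to `S₁`
    haveI := finiteDimensional_extendScalars_lift S₁
    haveI := isGalois_extendScalars_lift S₁
    have hcard :
        finrank (lift S₁).toSubfield (Subfield.extendScalars (lift_toSubfield_le S₁)) < n := by
      rw [finrank_extendScalars_lift, IntermediateField.finrank_fixedField_eq_card, ← hn,
        ← IsGalois.card_aut_eq_finrank, ← Subgroup.card_mul_index H', hH'i]
      have h1 : 0 < Nat.card H' := Nat.card_pos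
      have h2 : 1 < p := (Fact.out : p.Prime).one_lt
      calc Nat.card H' = Nat.card H' * 1 := (mul_one _).symm
        _ < Nat.card H' * p := Nat.mul_lt_mul_of_pos_left h2 h1
    have hP : IsPGroup p
        (Subfield.extendScalars (lift_toSubfield_le S₁) ≃ₐ[(lift S₁).toSubfield]
          Subfield.extendScalars (lift_toSubfield_le S₁)) := by
      refine isPGroup_extendScalars_lift S₁ ?_
      rw [IntermediateField.fixingSubgroup_fixedField]
      exact hG.to_subgroup H'
    obtain ⟨K', hK'⟩ := exists_rebase_intermediateField S₁ K hS₁K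
    have htower := ih _ hcard (lift S₁).toSubfield
      (Subfield.extendScalars (lift_toSubfield_le S₁)) hP rfl K'
    rw [hK'] at htower
    exact IsNormalPTower.step hstep htower

/-- The `p`-group case for the top field: `L` itself is reached from `M` by a tower of normal
extensions of degree `p`. [cite: Kuhlmann2010, Section 5, proof of (R4) (p. 19)] -/
theorem isNormalPTower_top_of_isGalois_of_isPGroup {p : ℕ} [Fact p.Prime] (M : Subfield Ω)
    (L : IntermediateField M Ω) [FiniteDimensional M L] [IsGalois M L]
    (hG : IsPGroup p (L ≃ₐ[M] L)) : IsNormalPTower p M L.toSubfield := by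
  have h := isNormalPTower_of_isGalois_of_isPGroup (finrank M L) M L hG rfl ⊤
  rwa [IntermediateField.lift_top] at h


/-! ### The purely inseparable case -/

/-- **A finite extension generated by `p`-power roots is a tower of normal extensions of degree
`p`** (Kuhlmann 2010, p. 19: the purely inseparable part of `E.F^r|F^r` "is a finite tower of
normal extensions of degree `p`, … purely inseparable"). Inside `Ω` of characteristic `p`:
subfields `M ≤ E` with `[E : M]` finite and `x^{p^k} ∈ M` for every `x ∈ E`; then
`IsNormalPTower p M E`. Proof by induction on `[E : M]`: if `E ≠ M` pick `z ∈ E ∖ M` with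
`z^p ∈ M`; then `M(z)|M` has degree `p` (`X^p - z^p` is irreducible over `M`) and is purely
inseparable, hence normal; continue over `M(z)`.
[cite: Kuhlmann2010, Section 5, proof of (R4) (p. 19)] -/
theorem isNormalPTower_of_forall_pow_mem {p : ℕ} [hp : Fact p.Prime] [CharP Ω p] (n : ℕ) :
    ∀ (M E : Subfield Ω), M ≤ E → (∀ x ∈ E, ∃ k : ℕ, x ^ p ^ k ∈ M) →
      Subfield.relfinrank M E = n → 0 < n → IsNormalPTower p M E := by
  classical
  induction n using Nat.strong_induction_on with
  | _ n ih =>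
  intro M E hME hpow hn hn0
  by_cases hEM : E ≤ M
  · rw [le_antisymm hEM hME]
    exact IsNormalPTower.refl M
  · obtain ⟨y, hyE, hyM⟩ := Set.not_subset.mp hEM
    have hex : ∃ k : ℕ, y ^ p ^ k ∈ M := hpow y hyE
    let k := Nat.find hex
    have hk : y ^ p ^ k ∈ M := Nat.find_spec hex
    have hk0 : k ≠ 0 := by
      intro h0
      rw [h0, pow_zero, pow_one] at hk
      exact hyM hk
    set z : Ω := y ^ p ^ (k - 1) with hz
    have hzE : z ∈ E := E.pow_mem hyE _
    have hzM : z ∉ M := Nat.find_min hex (Nat.sub_one_lt hk0)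
    have hzp : z ^ p ∈ M := by
      rw [hz, ← pow_mul, ← pow_succ, Nat.sub_one_add_one hk0]
      exact hk
    -- the step `M ≤ M(z)`
    haveI : CharP M p := inferInstance
    haveI : ExpChar M p := ExpChar.prime hp.out
    let c : M := ⟨z ^ p, hzp⟩
    have hirr : Irreducible (X ^ p - C c) := by
      refine X_pow_sub_C_irreducible_of_prime hp.out fun b hb => hzM ?_
      have hb' : (b : Ω) ^ p = z ^ p := by
        have := congrArg (fun t : M => (t : Ω)) hb
        simpa using this
      have h0 : ((b : Ω) - z) ^ p = 0 := by rw [sub_pow_char, hb', sub_self]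
      have hbz : (b : Ω) = z := sub_eq_zero.mp (pow_eq_zero_iff (hp.out.ne_zero) |>.mp h0)
      rw [← hbz]
      exact b.2
    have hmonic : (X ^ p - C c).Monic := monic_X_pow_sub_C c hp.out.ne_zero
    have haeval : aeval z (X ^ p - C c) = 0 := by
      rw [map_sub, aeval_X_pow, aeval_C, sub_eq_zero]
      rfl
    have hint : IsIntegral M z := ⟨X ^ p - C c, hmonic, by rwa [← aeval_def]⟩
    have hmin : minpoly M z = X ^ p - C c :=
      (minpoly.eq_of_irreducible_of_monic hirr haeval hmonic).symm
    let K : IntermediateField M Ω := M⟮z⟯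
    have hKd : finrank M K = p := by
      rw [IntermediateField.adjoin.finrank hint, hmin, natDegree_X_pow_sub_C]
    haveI : IsPurelyInseparable M K := by
      rw [IntermediateField.isPurelyInseparable_adjoin_simple_iff_pow_mem M Ω p]
      exact ⟨1, ⟨c, by rw [pow_one]; rfl⟩⟩
    haveI : Normal M K := IsPurelyInseparable.normal M K
    have hstep : IsNormalStep p M K.toSubfield := (isNormalStep_iff K).mpr ⟨hKd, inferInstance⟩
    -- recurse over `M(z)`
    have hMK : M ≤ K.toSubfield := subfield_le_toSubfield K
    have hKE : K.toSubfield ≤ E := by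
      have : K ≤ Subfield.extendScalars hME := by
        rw [IntermediateField.adjoin_le_iff]
        rintro _ rfl
        exact hzE
      exact fun x hx => this hx
    have hrel : Subfield.relfinrank M K.toSubfield = p := by
      rw [relfinrank_toSubfield_eq_finrank, hKd]
    have hmul : p * Subfield.relfinrank K.toSubfield E = n := by
      rw [← hrel, Subfield.relfinrank_mul_relfinrank hMK hKE, hn]
    have hlt : Subfield.relfinrank K.toSubfield E < n := by
      rw [← hmul]
      have h2 : 1 < p := hp.out.one_lt
      have h3 : 0 < Subfield.relfinrank K.toSubfield E := by
        rcases Nat.eq_zero_or_pos (Subfield.relfinrank K.toSubfield E) with h0 | h0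
        · rw [h0, mul_zero] at hmul; omega
        · exact h0
      calc Subfield.relfinrank K.toSubfield E
            = 1 * Subfield.relfinrank K.toSubfield E := (one_mul _).symm
        _ < p * Subfield.relfinrank K.toSubfield E := Nat.mul_lt_mul_of_pos_right h2 h3
    have hpos : 0 < Subfield.relfinrank K.toSubfield E := by
      rcases Nat.eq_zero_or_pos (Subfield.relfinrank K.toSubfield E) with h0 | h0
      · rw [h0, mul_zero] at hmul; omega
      · exact h0
    have htower := ih _ hlt K.toSubfield E hKE (fun x hx => ?_) rfl hpos
    · exact IsNormalPTower.step hstep htower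
    · obtain ⟨j, hj⟩ := hpow x hx
      exact ⟨j, hMK hj⟩

/-- **Finite purely inseparable extensions are towers of normal extensions of degree `p`**
(`p` the characteristic): `M ≤ Ω`, `E|M` a finite purely inseparable intermediate field of
`Ω|M`; then `IsNormalPTower p M E`. [cite: Kuhlmann2010, Section 5, proof of (R4) (p. 19)] -/
theorem isNormalPTower_of_isPurelyInseparable {p : ℕ} [hp : Fact p.Prime] [CharP Ω p]
    (M : Subfield Ω) (E : IntermediateField M Ω) [FiniteDimensional M E]
    [IsPurelyInseparable M E] : IsNormalPTower p M E.toSubfield := by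
  haveI : ExpChar M p := ExpChar.prime hp.out
  refine isNormalPTower_of_forall_pow_mem _ M E.toSubfield (subfield_le_toSubfield E)
    (fun x hx => ?_) rfl ?_
  · obtain ⟨k, c, hc⟩ := IsPurelyInseparable.pow_mem M p (⟨x, hx⟩ : E)
    refine ⟨k, ?_⟩
    have : ((⟨x, hx⟩ : E) ^ p ^ k : E) = ⟨x ^ p ^ k, pow_mem hx (p ^ k)⟩ := Subtype.ext rfl
    rw [this] at hc
    have h2 := congrArg (fun t : E => (t : Ω)) hc
    simp only at h2
    rw [← h2]
    exact c.2
  · rw [relfinrank_toSubfield_eq_finrank]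
    exact finrank_pos

/-- In characteristic `0`, a finite purely inseparable extension is trivial, hence (vacuously)
a tower. [folklore] -/
theorem isNormalPTower_of_isPurelyInseparable_of_charZero {p : ℕ} [CharZero Ω]
    (M : Subfield Ω) (E : IntermediateField M Ω) [FiniteDimensional M E]
    [IsPurelyInseparable M E] : IsNormalPTower p M E.toSubfield := by
  haveI : CharZero M := RingHom.charZero (algebraMap M Ω)
  haveI : PerfectField M := PerfectField.ofCharZero
  haveI : Algebra.IsSeparable M E := Algebra.IsAlgebraic.isSeparable_of_perfectField
  have hsurj := IsPurelyInseparable.surjective_algebraMap_of_isSeparable M E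
  have hE : E.toSubfield = M := by
    refine le_antisymm (fun x hx => ?_) (subfield_le_toSubfield E)
    obtain ⟨c, hc⟩ := hsurj ⟨x, hx⟩
    have := congrArg (fun t : E => (t : Ω)) hc
    simp only at this
    rw [← this]
    exact c.2
  rw [hE]
  exact IsNormalPTower.refl M

end Literature.AlgebraicGeometry.Resolution
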